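import Summits.CriticalPhenomena.PercolationContinuityZ3.Theorems.PercNearOneGluingNoHeavyLowerTailSunflowerMinorPetal
import HarnessLib
import HarnessLib.Audit

/-!
# `NoHeavyLowerTail` (crux stmt-CriticalPhenomena-4575), abstract sunflower cubic: `MinorSuperadditivity` (DC) at every NON-BOTTOM point

Support file (seat `prim-l12-p2` gen 20; `--supports stmt-CriticalPhenomena-4575`).  No `sorry`, no new definitions.
Memo: run/shared/lean/prim/prim-l12/prim-l12-p2/FINDING-g20-COMPLEMENT-READING.md §10–§11.

* `Sunflower.minorSuperadditivity_of_lab_insert_ne_zero` — the deletion–contraction superadditivity of the bottom slack,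
  `f(W∖x; C) + f(W∖x; C∪{x}) ≤ f(W; C)`, holds at every point `x ∈ W` with `lab (C ∪ {x}) ≠ 0` (dominant point: `…SunflowerMinorCube`;
  petal point: `…SunflowerMinorPetal`).  The typed conjecture `MinorSuperadditivity` (⇒ (★_B) ⇒ ★, `…SunflowerMinorInduction`) is thereby
  reduced to BOTTOM points, `lab (C ∪ {x}) = 0` (census: exhaustive n ≤ 5; anatomy memo §11).
-/

namespace Summit.CriticalPhenomena.PercolationContinuityZ3.Theorems.SunflowerPartition

open Finset

namespace Sunflower

variable {α : Type*} [Fintype α] [DecidableEq α] (F : Sunflower α)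

omit [Fintype α] in
/-- **(DC) AT EVERY NON-BOTTOM POINT** (this work): if `lab (C ∪ {x}) ≠ 0` then `f(W∖x; C) + f(W∖x; C∪{x}) ≤ f(W; C)`. [this work] -/
theorem minorSuperadditivity_of_lab_insert_ne_zero (W C : Finset α) (x : α) (hx : x ∈ W) (hWC : Disjoint W C)
    (h0 : F.lab (insert x C) ≠ 0) :
    F.minorSlack (W.erase x) C + F.minorSlack (W.erase x) (insert x C) ≤ F.minorSlack W C := by
  by_cases h4 : F.lab (insert x C) = 4
  · exact F.minorSuperadditivity_of_dominant W C x hx hWC h4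
  · exact F.minorSuperadditivity_of_petal W C x hx h0 h4

end Sunflower

end Summit.CriticalPhenomena.PercolationContinuityZ3.Theorems.SunflowerPartition
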